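import Literature.MathematicalPhysics.QuantumFieldTheory.Balaban1983to89.B1Ineq358TreeLength
import Literature.MathematicalPhysics.QuantumFieldTheory.Balaban1983to89.B1LowerBound

/-!
# `Balaban1983to89.B1Prop31DisplayedKernels` — T. Bałaban, *(Higgs)₂,₃ quantum fields in a finite volume. I. A lower bound*,
Commun. Math. Phys. **85** (1982) 603–626 [Balaban1982Higgs1], **Proposition 3.1** p. 620 [PDF 18], verbatim: *"The sum of R-terms of
the previously described expansion of the action S^{(k)} is of the order O(1)(Lᵏε)^κ|T₁^{(k)}| for some κ > d. Also of the same order is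
the sum of terms, for which the sum of the powers of the factors Lᵏε occurring at the vertices is greater than d. In these estimates O(1)
is independent of k, it depends only on the coupling constants and the number n̄.  This theorem will be obtained as a corollary of an
analysis of the perturbation expansions and its renormalization."*; part III [Balaban1983Higgs3] p. 421 [PDF 11]: *"Proposition I.3.1 is
completely obvious if we sum over localizations, use the restrictions on the fields and take n̄ large enough, e.g. n̄ > 6."*

statement-level skeleton of published theorems with citation tags; proofs where landed; nothing here is a claim about the Yang–Mills mass gap

PDF held: `paper:balaban1982-cmp85-higgs23-i` (journal page = PDF page + 602), p. 620 read from the text layer `p0018.txt` (the R-terms: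
*"terms having the additional factors of the form R_{n̄+1}(…) … The existence of such factors implies that there is the factor e(Lᵏε)^{n̄+1}
also and it gives the factor (Lᵏε)^κ for some κ > d. Such terms will be called R-terms"*); part III `paper:balaban1983-higgs-2-3-quantum-fields-
finite-volume` p. 421 `p0011.txt`.

CITATION HEADER (lean-in-tree rule).  Cell `lit-balaban` (HOME `run/shared/lean/pub/lit-balaban/`), unit `lit-balaban-typer` gen 17
(literature-prover-lit-balaban-typer-g17-0; TAKING line HOME/STATUS.md 2026-08-22T06:57Z; stem check: no `B1Prop31*` file, no inhabitation
of `B1LowerBound.Prop31Printed` anywhere in the tree).  SKELETON row served (cells only, no head change; fold owner r14, reader r12):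
**B1.Prop3.1** — decl of record r01's `B1LowerBound.Prop31Printed` / carrier `B1LowerBound.P31Setting` (`B1LowerBound.lean:221/:232`).
USED BY NAME, never restated: `B1LowerBound.{P31Setting, Prop31Printed}`, p14's `B1Ineq358TreeDecaySum.{poly357, polyConst, polyConst_nonneg}`
(the (3.57) carrier on the concrete tori and the p. 625 constant), p19's `B3Ineq213.treeLen` (the printed tree length), the typer's
`B1Ineq358TreeLength.abs_poly357_le_of_treeLen` (p14's summation under the PRINTED tree-length decay).

WHAT THIS FILE PROVES (KIND: model instance with DISPLAYED inputs — the pattern of the typer's `B2Ineq2116Region` for (II.2.116)/Prop. II.2.1).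
The decl of record quantifies over a family `fam : J → P31Setting` and asks for ONE `κ > d` and ONE constant `C` with
`|Rsum k| ≦ C·ell k^κ·volK k` and `|highSum k| ≦ C·ell k^κ·volK k` for all members and all steps.  Here `J = Run U` is the family of runs of the
concrete (Higgs)₂,₃ lattice model (`HiggsLattice.Params`, tori `T₁^{(k)} = HiggsLattice.Site P k`, mesh `ell k = Lᵏε`, `volK k = |T₁^{(k)}|`) whose
two sums at every step are DISPLAYED as p14's (3.57)-polynomials `poly357` — kernels `c(q; z; κ)` on `q ≦ q̄` points of `T₁^{(k)}` with labels,
legs `leg(κ_i, z_i)` — with the displayed hypotheses (fields of `Run`):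
 (R)  `|c_R(q;z;κ)| ≦ C₀·(Lᵏε)^κ·e^{−δ₀·d(z)}` — the R-terms carry *"the factor (Lᵏε)^κ for some κ > d"* (p. 620) and the tree decay of the
      renormalized expansion (III (1.33), `d(z)` = p19's `treeLen` of the point tuple in the distance (I.1.3), AS PRINTED);
 (H)  the same for the high-order terms;
 (F)  *"the restrictions on the fields"*: `|leg| ≦ q₀`;
with the constants `U : Consts` (`d`, `κ > d`, `δ₀ > 0`, `C₀ ≧ 0`, `q₀ ≧ 0`, `q̄`, number of labels) shared by the family — *"O(1) … depends
only on the coupling constants and the number n̄"*.  THEOREM **`prop31Printed_run`**: `B1LowerBound.Prop31Printed (fun i : Run U => i.toP31)`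
with `κ = U.κ` and the ONE constant `constC U = C₀·polyConst(q̄, nLbl, q₀, d, δ₀)` — III p. 421's *"sum over localizations"* done by
`abs_poly357_le_of_treeLen` (every localization tuple summed over the torus, `Σ_z e^{−δ₀d(z)} ≦ |T₁^{(k)}|·treeConst`).  Non-vacuity:
**`run_zero`** (every lattice carries the run with vanishing kernels) and `toP31_volK`/`toP31_ell` (the carrier's reals ARE `|T₁^{(k)}|`, `Lᵏε`).

HONEST SCOPE.  (a) Proposition 3.1 AS A STATEMENT ABOUT BAŁABAN'S EXPANSION is NOT proved: that the R-terms / high-order terms of the actual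
expansion of `S^{(k)}` have the displayed form (R)/(H)/(F) is paper III's Proposition 1 + *"take n̄ large enough"* (the power counting
`κ > d` from `n̄ > 6`), displayed here as the fields `hcoefR`/`hcoefH`/`hlegR`/`hlegH`; what IS kernel-checked is the passage *"sum over
localizations"* from those displayed per-localization bounds to the printed `O(1)(Lᵏε)^κ|T₁^{(k)}|` with a `k`- and `ε`-independent `O(1)`.
(b) One label alphabet `Fin U.nLbl` and one leg function per step serve both sums (a modelling convenience; two alphabets embed in their
disjoint union).  (c) KIND model instance / displayed inputs: the row's head is the owner's and the referees' call (PARTIAL per §C.6 is the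
expected reading); nothing here is summit progress.
-/

open scoped BigOperators

namespace Literature.MathematicalPhysics.QuantumFieldTheory.Balaban1983to89.B1Prop31DisplayedKernels

open Literature.MathematicalPhysics.QuantumFieldTheory.Balaban1983to89.B3Ineq213 (treeLen)
open Literature.MathematicalPhysics.QuantumFieldTheory.Balaban1983to89.B1Ineq358TreeDecaySum (poly357 polyConst polyConst_nonneg)
open Literature.MathematicalPhysics.QuantumFieldTheory.Balaban1983to89.B1Ineq358TreeLength (abs_poly357_le_of_treeLen)

/-! ## §1 The displayed constants and the family of runs -/

/-- The constants shared by the family (*"O(1) is independent of k, it depends only on the coupling constants and the number n̄"*):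
the dimension `d`, the exponent `κ > d` of the R-terms, the tree-decay rate `δ₀ > 0` and constant `C₀ ≧ 0` of the kernels, the field bound
`q₀ ≧ 0`, the maximal number of legs `qmax` (= n(n̄)) and the number of leg labels `nLbl`. [cite: Balaban1982Higgs1, Prop. 3.1 p.620] -/
structure Consts where
  /-- dimension -/
  d : ℕ
  /-- the exponent of the R-terms, *"κ > d"* -/
  κ : ℝ
  hκ : (d : ℝ) < κ
  /-- tree-decay rate of the kernels -/
  δ₀ : ℝ
  hδ₀ : 0 < δ₀
  /-- kernel constant -/
  C₀ : ℝ
  hC₀ : 0 ≤ C₀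
  /-- *"the restrictions on the fields"*: `|leg| ≦ q₀` -/
  q₀ : ℝ
  hq₀ : 0 ≤ q₀
  /-- maximal number of legs of a term -/
  qmax : ℕ
  /-- number of leg labels (field components, derivatives, …) -/
  nLbl : ℕ

/-- ONE RUN of the concrete lattice model with its R-terms and high-order terms DISPLAYED: a lattice `P` of dimension `U.d`; for every step
`k`, kernels `coefR k q z κ` / `coefH k q z κ` on `q`-tuples of points of `T₁^{(k)}` with labels in `Fin U.nLbl` and legs `leg k l x`, so that
the two sums of Prop. 3.1 are the (3.57)-polynomials `poly357 U.qmax (coefR k) (leg k)` and `poly357 U.qmax (coefH k) (leg k)`; and the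
displayed hypotheses (R)/(H) `|c(q;z;κ)| ≦ C₀(Lᵏε)^κ e^{−δ₀·d(z)}` (tree length AS PRINTED) for `q ≦ qmax`, (F) `|leg| ≦ q₀`.
[cite: Balaban1982Higgs1, Prop. 3.1 p.620; Balaban1983Higgs3, (1.33) p.420, p.421] -/
structure Run (U : Consts) where
  /-- the lattice of the run -/
  P : HiggsLattice.Params
  hd : P.d = U.d
  /-- kernels of the R-terms at step `k` -/
  coefR : (k : ℕ) → (q : ℕ) → (Fin q → HiggsLattice.Site P k) → (Fin q → Fin U.nLbl) → ℝ
  /-- kernels of the high-order terms at step `k` -/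
  coefH : (k : ℕ) → (q : ℕ) → (Fin q → HiggsLattice.Site P k) → (Fin q → Fin U.nLbl) → ℝ
  /-- the legs (restricted fields) at step `k` -/
  leg : (k : ℕ) → Fin U.nLbl → HiggsLattice.Site P k → ℝ
  /-- (R): the R-terms carry `(Lᵏε)^κ` and the printed tree decay -/
  hcoefR : ∀ k q, q ≤ U.qmax → ∀ (z : Fin q → HiggsLattice.Site P k) (κ : Fin q → Fin U.nLbl),
    |coefR k q z κ| ≤ U.C₀ * P.mesh k ^ U.κ * Real.exp (-(U.δ₀ * treeLen (fun i j => (HiggsLattice.Site.tdist (z i) (z j) : ℝ))))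
  /-- (H): the same for the high-order terms -/
  hcoefH : ∀ k q, q ≤ U.qmax → ∀ (z : Fin q → HiggsLattice.Site P k) (κ : Fin q → Fin U.nLbl),
    |coefH k q z κ| ≤ U.C₀ * P.mesh k ^ U.κ * Real.exp (-(U.δ₀ * treeLen (fun i j => (HiggsLattice.Site.tdist (z i) (z j) : ℝ))))
  /-- (F): *"the restrictions on the fields"* -/
  hleg : ∀ k l x, |leg k l x| ≤ U.q₀

namespace Run

variable {U : Consts}

/-- The sum of the R-terms at step `k`: the (3.57)-polynomial of the displayed kernels. [cite: Balaban1982Higgs1, Prop. 3.1 p.620] -/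
def Rsum (i : Run U) (k : ℕ) : ℝ := poly357 U.qmax (i.coefR k) (i.leg k)

/-- The sum of the high-order terms at step `k`. [cite: Balaban1982Higgs1, Prop. 3.1 p.620] -/
def highSum (i : Run U) (k : ℕ) : ℝ := poly357 U.qmax (i.coefH k) (i.leg k)

/-- The run as a member of r01's carrier `P31Setting`: `Rsum`, `highSum` as displayed, `volK k = |T₁^{(k)}|`, `ell k = Lᵏε`, `d`.
[cite: Balaban1982Higgs1, Prop. 3.1 p.620] -/
noncomputable def toP31 (i : Run U) : B1LowerBound.P31Setting where
  d := U.d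
  Rsum := i.Rsum
  highSum := i.highSum
  volK := fun k => (Fintype.card (HiggsLattice.Site i.P k) : ℝ)
  ell := fun k => i.P.mesh k

/-- The carrier's volume IS the number of points of `T₁^{(k)}`. [cite: Balaban1982Higgs1, Prop. 3.1 p.620] -/
theorem toP31_volK (i : Run U) (k : ℕ) : i.toP31.volK k = Fintype.card (HiggsLattice.Site i.P k) := rfl

/-- The carrier's scale IS the mesh `Lᵏε`. [cite: Balaban1982Higgs1, Prop. 3.1 p.620; (1.19) p.607] -/
theorem toP31_ell (i : Run U) (k : ℕ) : i.toP31.ell k = i.P.mesh k := rfl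

end Run

/-! ## §2 The one constant and the bound per step -/

/-- The ONE constant of the family: `C₀ · polyConst(qmax, nLbl, q₀, d, δ₀)` — p14's p. 625 constant (the sum over localizations and labels)
times the kernel constant. [cite: Balaban1982Higgs1, Prop. 3.1 p.620, p.625; Balaban1983Higgs3, p.421] -/
noncomputable def constC (U : Consts) : ℝ := U.C₀ * polyConst U.qmax (U.nLbl : ℝ) U.q₀ U.d U.δ₀

variable {U : Consts}

/-- **The summation over localizations** (III p. 421) for one displayed polynomial: kernels `≦ C₀(Lᵏε)^κe^{−δ₀d(z)}` (`q ≦ qmax`), legs `≦ q₀`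
⇒ `|poly357| ≦ constC·(Lᵏε)^κ·|T₁^{(k)}|` — `abs_poly357_le_of_treeLen` with `A₀ = C₀(Lᵏε)^κ`. [cite: Balaban1982Higgs1, Prop. 3.1 p.620; Balaban1983Higgs3, p.421] -/
theorem abs_poly357_le_constC (i : Run U) (k : ℕ)
    (coef : (q : ℕ) → (Fin q → HiggsLattice.Site i.P k) → (Fin q → Fin U.nLbl) → ℝ)
    (hcoef : ∀ q, q ≤ U.qmax → ∀ (z : Fin q → HiggsLattice.Site i.P k) (κ : Fin q → Fin U.nLbl),
      |coef q z κ| ≤ U.C₀ * i.P.mesh k ^ U.κ * Real.exp (-(U.δ₀ * treeLen (fun a b => (HiggsLattice.Site.tdist (z a) (z b) : ℝ))))) :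
    |poly357 U.qmax coef (i.leg k)| ≤ constC U * i.P.mesh k ^ U.κ * (Fintype.card (HiggsLattice.Site i.P k) : ℝ) := by
  have hA₀ : 0 ≤ U.C₀ * i.P.mesh k ^ U.κ := mul_nonneg U.hC₀ (Real.rpow_nonneg (i.P.mesh_pos k).le U.κ)
  have h := abs_poly357_le_of_treeLen U.qmax coef (i.leg k) hA₀ U.hδ₀ U.hq₀ hcoef (i.hleg k)
  have hcard : (Fintype.card (Fin U.nLbl) : ℝ) = U.nLbl := by simp
  rw [hcard, i.hd] at h
  calc |poly357 U.qmax coef (i.leg k)|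
      ≤ U.C₀ * i.P.mesh k ^ U.κ * (Fintype.card (HiggsLattice.Site i.P k) : ℝ) * polyConst U.qmax (U.nLbl : ℝ) U.q₀ U.d U.δ₀ := h
    _ = constC U * i.P.mesh k ^ U.κ * (Fintype.card (HiggsLattice.Site i.P k) : ℝ) := by unfold constC; ring

/-- The R-terms of a run at step `k`: `|Rsum k| ≦ constC·(Lᵏε)^κ·|T₁^{(k)}|`. [cite: Balaban1982Higgs1, Prop. 3.1 p.620] -/
theorem abs_Rsum_le (i : Run U) (k : ℕ) :
    |i.Rsum k| ≤ constC U * i.P.mesh k ^ U.κ * (Fintype.card (HiggsLattice.Site i.P k) : ℝ) :=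
  abs_poly357_le_constC i k (i.coefR k) (i.hcoefR k)

/-- The high-order terms of a run at step `k`: `|highSum k| ≦ constC·(Lᵏε)^κ·|T₁^{(k)}|`. [cite: Balaban1982Higgs1, Prop. 3.1 p.620] -/
theorem abs_highSum_le (i : Run U) (k : ℕ) :
    |i.highSum k| ≤ constC U * i.P.mesh k ^ U.κ * (Fintype.card (HiggsLattice.Site i.P k) : ℝ) :=
  abs_poly357_le_constC i k (i.coefH k) (i.hcoefH k)

/-! ## §3 Row B1.Prop3.1 — the decl of record inhabited for the displayed-input family -/

/-- **Proposition 3.1 AS TYPED (`B1LowerBound.Prop31Printed`) for the family `Run U`**: ONE exponent `κ = U.κ > d` and ONE constant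
`constC U`, independent of the run (hence of `ε`, of the torus) and of the step `k`, with `|Rsum k| ≦ C(Lᵏε)^κ|T₁^{(k)}|` and
`|highSum k| ≦ C(Lᵏε)^κ|T₁^{(k)}|` — *"of the order O(1)(Lᵏε)^κ|T₁^{(k)}| for some κ > d … O(1) is independent of k"* — from the displayed
per-localization bounds by the summation over localizations (III p. 421). [cite: Balaban1982Higgs1, Prop. 3.1 p.620; Balaban1983Higgs3, p.421] -/
theorem prop31Printed_run (U : Consts) : B1LowerBound.Prop31Printed (fun i : Run U => i.toP31) :=
  ⟨U.κ, constC U, fun _ => U.hκ, fun i k => ⟨abs_Rsum_le i k, abs_highSum_le i k⟩⟩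

/-! ## §4 Non-vacuity -/

/-- **Every lattice of dimension `d` carries a run of the family** (vanishing kernels and legs satisfy (R)/(H)/(F)), so the `∃ κ C` of the decl
of record quantifies over an inhabited family containing every torus `T₁^{(k)}` of the model. [cite: Balaban1982Higgs1, Prop. 3.1 p.620] -/
def run_zero (U : Consts) (P : HiggsLattice.Params) (hd : P.d = U.d) : Run U where
  P := P
  hd := hd
  coefR := fun _ _ _ _ => 0
  coefH := fun _ _ _ _ => 0
  leg := fun _ _ _ => 0
  hcoefR := fun k _ _ _ _ => by
    rw [abs_zero]
    exact mul_nonneg (mul_nonneg U.hC₀ (Real.rpow_nonneg (P.mesh_pos k).le U.κ)) (Real.exp_nonneg _)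
  hcoefH := fun k _ _ _ _ => by
    rw [abs_zero]
    exact mul_nonneg (mul_nonneg U.hC₀ (Real.rpow_nonneg (P.mesh_pos k).le U.κ)) (Real.exp_nonneg _)
  hleg := fun _ _ _ => by rw [abs_zero]; exact U.hq₀

/-- The zero run lives on the prescribed lattice. [cite: Balaban1982Higgs1, Prop. 3.1 p.620] -/
theorem run_zero_P (U : Consts) (P : HiggsLattice.Params) (hd : P.d = U.d) : (run_zero U P hd).P = P := rfl

/-- The family is inhabited as soon as a lattice of dimension `U.d` is given. [cite: Balaban1982Higgs1, Prop. 3.1 p.620] -/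
theorem run_nonempty (U : Consts) (P : HiggsLattice.Params) (hd : P.d = U.d) : Nonempty (Run U) := ⟨run_zero U P hd⟩

/-- The constant is non-negative (so the printed `O(1)` is a genuine size bound, not vacuous by sign). [cite: Balaban1982Higgs1, Prop. 3.1 p.620] -/
theorem constC_nonneg (U : Consts) : 0 ≤ constC U :=
  mul_nonneg U.hC₀ (polyConst_nonneg U.qmax (mul_nonneg (Nat.cast_nonneg _) U.hq₀) U.d U.hδ₀.le)

end Literature.MathematicalPhysics.QuantumFieldTheory.Balaban1983to89.B1Prop31DisplayedKernels
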